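import Literature.Probability.LatticeModels.SixVertexGFFProofs

/-!
# Planar six-vertex measure: expectations of local observables as iterated torus limits
# (DKLM 2026, Theorem 2.2 / Definition 2.4)

H. Duminil-Copin, K. K. Kozlowski, P. Lammers, I. Manolescu, *Gaussian free field convergence of
the six-vertex model with `-1 ≤ Δ ≤ -1/2`*, arXiv:2603.06268 (2026) [DKLM2026SixVertexGFF]
(`paper:arxiv-2603.06268`, chunks p0009–p0010):

> **Theorem 2.2.** […] the measures `ℙ_{𝕋_{M,L}}[· | balanced]` converge weakly, as `M → ∞` and
> then `L → ∞`, to a probability measure `ℙ` on arrow configurations of `ℤ²` […]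
> **Definition 2.4.** […] `Φ_k(u) := 𝔼[∏ᵢ (h(uᵢ') - h(uᵢ))]`.

`IsPlanarSixVertexMeasure a b c P` (the statement file) records Theorem 2.2 as the convergence of
the probabilities of *window events* `{planeWindow n ∈ S}`. This file draws the two elementary
consequences needed to feed the planar correlation functions `Φ_k = kPoint P k` into the
transfer-matrix analysis of the torus/cylinder measures (Part III):

1. **expectations of window-local observables are iterated limits of torus expectations**
   (`IsPlanarSixVertexMeasure.exists_tendsto_integral_comp_planeWindow`): for every
   `g : Config(window) → ℝ`, `𝔼_P[g ∘ planeWindow n] = lim_ℓ lim_M 𝔼_{𝕋_{M,2ℓ}}[g ∘ torusWindow n | balanced]`,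
   the torus expectation being the finite sum `∑_s g(s) ℙ_𝕋[torusWindow n = s | balanced]`
   (`torusWindowExp`);
2. **height differences at lattice faces are window-local** (`heightAt_windowExtend_planeWindow`:
   `h(f)` only reads arrows in the box of radius `|f₁| + |f₂| + 1`), hence so is the integrand of
   `Φ_k` (`kPoint_eq_integral_windowKPoint`), and
   **`Φ_k(u) = lim_ℓ lim_M 𝔼_{𝕋_{M,2ℓ}}[∏ᵢ (h(uᵢ') - h(uᵢ)) read in the window | balanced]`**
   (`IsPlanarSixVertexMeasure.exists_tendsto_kPoint`).

* `torusWindowExp`, `integral_comp_planeWindow_eq_sum`,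
  `IsPlanarSixVertexMeasure.exists_tendsto_integral_comp_planeWindow`;
* `windowExtend` (a window pattern as a planar configuration), `windowExtend_planeWindow`,
  `zsumIco_congr`, `heightAt_congr`, `heightAt_windowExtend_planeWindow`, `windowRadius`,
  `windowKPoint`, `kPoint_eq_integral_windowKPoint`, `IsPlanarSixVertexMeasure.exists_tendsto_kPoint`.

## References

* H. Duminil-Copin, K. K. Kozlowski, P. Lammers, I. Manolescu, arXiv:2603.06268 (2026),
  Theorem 2.2, Definitions 2.3–2.4. [DKLM2026SixVertexGFF]
-/

noncomputable section

open MeasureTheory Set Filter Topology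

namespace Literature.Probability.LatticeModels.SixVertex

/-! ## 1. Expectations of window-local observables -/

/-- **`𝔼_{𝕋_{M,L}}[g ∘ torusWindow n | balanced]`** as the finite sum
`∑_s g(s) ℙ_{𝕋_{M,L}}[torusWindow n = s | balanced]` over window patterns `s`.
[cite: DKLM2026SixVertexGFF, Def. 2.1 and Thm. 2.2] -/
def torusWindowExp (a b c : ℝ) (M L n : ℕ) (g : Config (Fin (2 * n + 1) × Fin (2 * n + 1)) → ℝ) : ℝ :=
  ∑ s : Config (Fin (2 * n + 1) × Fin (2 * n + 1)), g s * torusCondProbNat a b c M L n {s}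

/-- The integral of a window-local observable is a finite sum over window patterns:
`∫ g(planeWindow n ω) dP = ∑_s g(s) P{planeWindow n = s}`. [folklore] -/
theorem integral_comp_planeWindow_eq_sum (P : Measure (Config (ℤ × ℤ))) [IsFiniteMeasure P] (n : ℕ)
    (g : Config (Fin (2 * n + 1) × Fin (2 * n + 1)) → ℝ) :
    ∫ ω, g (planeWindow n ω) ∂P =
      ∑ s : Config (Fin (2 * n + 1) × Fin (2 * n + 1)), g s * (P {ω | planeWindow n ω ∈ ({s} : Set _)}).toReal := by
  have hpt : ∀ ω : Config (ℤ × ℤ), g (planeWindow n ω) =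
      ∑ s : Config (Fin (2 * n + 1) × Fin (2 * n + 1)),
        ({ω' : Config (ℤ × ℤ) | planeWindow n ω' ∈ ({s} : Set _)} : Set _).indicator (fun _ => g s) ω := by
    intro ω
    rw [Finset.sum_eq_single (planeWindow n ω)]
    · rw [indicator_of_mem (show ω ∈ {ω' : Config (ℤ × ℤ) | planeWindow n ω' ∈ ({planeWindow n ω} : Set _)} from rfl)]
    · intro s _ hs
      rw [indicator_of_notMem]
      exact fun h => hs (mem_singleton_iff.1 h).symm
    · intro h; exact absurd (Finset.mem_univ _) h
  simp_rw [hpt]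
  rw [integral_finsetSum _ fun s _ => (integrable_const (g s)).indicator (measurableSet_window n {s})]
  refine Finset.sum_congr rfl fun s _ => ?_
  rw [integral_indicator_const _ (measurableSet_window n {s}), smul_eq_mul, mul_comm, measureReal_def]

/-- **Expectations of window-local observables under the planar measure are iterated torus limits**:
`𝔼_P[g ∘ planeWindow n] = lim_{ℓ→∞} lim_{M→∞} 𝔼_{𝕋_{M,2ℓ}}[g ∘ torusWindow n | balanced]` (the inner
limits exist), by linearity from the defining property of `P` (Theorem 2.2 read on window events).
[cite: DKLM2026SixVertexGFF, Thm. 2.2 and Def. 2.4] -/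
theorem IsPlanarSixVertexMeasure.exists_tendsto_integral_comp_planeWindow {a b c : ℝ} {P : Measure (Config (ℤ × ℤ))}
    (hP : IsPlanarSixVertexMeasure a b c P) (n : ℕ) (g : Config (Fin (2 * n + 1) × Fin (2 * n + 1)) → ℝ) :
    ∃ q : ℕ → ℝ, (∀ ℓ : ℕ, Tendsto (fun M : ℕ => torusWindowExp a b c M (2 * ℓ) n g) atTop (𝓝 (q ℓ))) ∧
      Tendsto q atTop (𝓝 (∫ ω, g (planeWindow n ω) ∂P)) := by
  haveI := hP.1
  choose q hq hq' using fun s : Config (Fin (2 * n + 1) × Fin (2 * n + 1)) => hP.2 n {s}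
  refine ⟨fun ℓ => ∑ s, g s * q s ℓ, fun ℓ => tendsto_finsetSum _ fun s _ => (hq s ℓ).const_mul (g s), ?_⟩
  rw [integral_comp_planeWindow_eq_sum P n g]
  exact tendsto_finsetSum _ fun s _ => (hq' s).const_mul (g s)

/-! ## 2. Height differences at lattice faces are window-local -/

/-- A window pattern read as a planar configuration (arrows outside the box `[-n,n]²` set to
`(false,false)`; only the arrows inside the box are ever read below). [folklore] -/
def windowExtend (n : ℕ) (w : Config (Fin (2 * n + 1) × Fin (2 * n + 1))) : Config (ℤ × ℤ) := fun v =>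
  if h : |v.1| ≤ n ∧ |v.2| ≤ n then
    w (⟨(v.1 + n).toNat, by have := abs_le.1 h.1; omega⟩, ⟨(v.2 + n).toNat, by have := abs_le.1 h.2; omega⟩)
  else (false, false)

/-- Inside the box, the extension of the window of `ω` is `ω`. [folklore] -/
theorem windowExtend_planeWindow (n : ℕ) (ω : Config (ℤ × ℤ)) {v : ℤ × ℤ} (h1 : |v.1| ≤ n) (h2 : |v.2| ≤ n) :
    windowExtend n (planeWindow n ω) v = ω v := by
  have h1' := abs_le.1 h1
  have h2' := abs_le.1 h2
  rw [windowExtend, dif_pos ⟨h1, h2⟩, planeWindow]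
  congr 1
  ext <;> simp only <;> omega

/-- Signed interval sums only read their summands on the interval. [folklore] -/
theorem zsumIco_congr {f g : ℤ → ℤ} {a b : ℤ} (h : ∀ k, min a b ≤ k → k < max a b → f k = g k) :
    zsumIco f a b = zsumIco g a b := by
  unfold zsumIco
  split_ifs with hab
  · refine Finset.sum_congr rfl fun k hk => h k ?_ ?_
    · rw [Finset.mem_Ico] at hk; rw [min_eq_left hab]; exact hk.1
    · rw [Finset.mem_Ico] at hk; rw [max_eq_right hab]; exact hk.2
  · push Not at hab
    congr 1
    refine Finset.sum_congr rfl fun k hk => h k ?_ ?_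
    · rw [Finset.mem_Ico] at hk; rw [min_eq_right hab.le]; exact hk.1
    · rw [Finset.mem_Ico] at hk; rw [max_eq_left hab.le]; exact hk.2

/-- **Locality of the height function**: `h(f)` (Definition 2.3, normalised at the face `(0,0)`)
only reads the arrows at vertices `v` with `|v₁| ≤ |f₁| + 1`, `|v₂| ≤ |f₂| + 1`.
[cite: DKLM2026SixVertexGFF, Def. 2.3] -/
theorem heightAt_congr {ω ω' : Config (ℤ × ℤ)} {f : ℤ × ℤ} {n : ℕ} (hf1 : |f.1| + 1 ≤ n) (hf2 : |f.2| + 1 ≤ n)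
    (h : ∀ v : ℤ × ℤ, |v.1| ≤ n → |v.2| ≤ n → ω v = ω' v) : heightAt ω f = heightAt ω' f := by
  have a1 := le_abs_self f.1
  have a2 := neg_abs_le f.1
  have b1 := le_abs_self f.2
  have b2 := neg_abs_le f.2
  unfold heightAt
  congr 1
  · refine zsumIco_congr fun k hk1 hk2 => ?_
    simp only [eastStep]
    rw [h (k + 1, 0) ?_ (by simp)]
    show |k + 1| ≤ (n : ℤ)
    rw [abs_le]
    constructor <;> omega
  · refine zsumIco_congr fun k hk1 hk2 => ?_
    simp only [northStep]
    rw [h (f.1, k + 1) (by show |f.1| ≤ (n : ℤ); omega) ?_]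
    show |k + 1| ≤ (n : ℤ)
    rw [abs_le]
    constructor <;> omega

/-- The height at a face inside the window is a function of the window pattern:
`h_ω(f) = h_{windowExtend(planeWindow n ω)}(f)` for `|f₁| + 1, |f₂| + 1 ≤ n`.
[cite: DKLM2026SixVertexGFF, Def. 2.3] -/
theorem heightAt_windowExtend_planeWindow {n : ℕ} (ω : Config (ℤ × ℤ)) {f : ℤ × ℤ} (hf1 : |f.1| + 1 ≤ n)
    (hf2 : |f.2| + 1 ≤ n) : heightAt (windowExtend n (planeWindow n ω)) f = heightAt ω f :=
  heightAt_congr hf1 hf2 fun _ h1 h2 => windowExtend_planeWindow n ω h1 h2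

/-! ## 3. `Φ_k` as an iterated torus limit -/

/-- A window radius large enough for all the faces `⌊uᵢ⌋, ⌊uᵢ'⌋` of a configuration `u`. [folklore] -/
def windowRadius {k : ℕ} (u : Fin k → ℂ × ℂ) : ℕ :=
  (Finset.univ.sup fun i : Fin k =>
    max (max (⌊(u i).1.re⌋.natAbs) (⌊(u i).1.im⌋.natAbs)) (max (⌊(u i).2.re⌋.natAbs) (⌊(u i).2.im⌋.natAbs))) + 1

/-- The faces of `u` lie inside the window of radius `windowRadius u`. [folklore] -/
theorem abs_floor_le_windowRadius {k : ℕ} (u : Fin k → ℂ × ℂ) (i : Fin k) :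
    |⌊(u i).1.re⌋| + 1 ≤ (windowRadius u : ℤ) ∧ |⌊(u i).1.im⌋| + 1 ≤ (windowRadius u : ℤ) ∧
      |⌊(u i).2.re⌋| + 1 ≤ (windowRadius u : ℤ) ∧ |⌊(u i).2.im⌋| + 1 ≤ (windowRadius u : ℤ) := by
  have hle : max (max (⌊(u i).1.re⌋.natAbs) (⌊(u i).1.im⌋.natAbs)) (max (⌊(u i).2.re⌋.natAbs) (⌊(u i).2.im⌋.natAbs)) ≤
      Finset.univ.sup fun i : Fin k =>
        max (max (⌊(u i).1.re⌋.natAbs) (⌊(u i).1.im⌋.natAbs)) (max (⌊(u i).2.re⌋.natAbs) (⌊(u i).2.im⌋.natAbs)) :=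
    Finset.le_sup (f := fun i : Fin k =>
      max (max (⌊(u i).1.re⌋.natAbs) (⌊(u i).1.im⌋.natAbs)) (max (⌊(u i).2.re⌋.natAbs) (⌊(u i).2.im⌋.natAbs)))
      (Finset.mem_univ i)
  unfold windowRadius
  rw [Nat.cast_add, Nat.cast_one, ← Int.natCast_natAbs ⌊(u i).1.re⌋, ← Int.natCast_natAbs ⌊(u i).1.im⌋,
    ← Int.natCast_natAbs ⌊(u i).2.re⌋, ← Int.natCast_natAbs ⌊(u i).2.im⌋]
  refine ⟨?_, ?_, ?_, ?_⟩ <;> omega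

/-- **The integrand of `Φ_k` read in the window**: `∏ᵢ (h(uᵢ') - h(uᵢ))` computed from the window
pattern (via `windowExtend`). [cite: DKLM2026SixVertexGFF, Def. 2.4] -/
def windowKPoint {k : ℕ} (u : Fin k → ℂ × ℂ) (n : ℕ) (w : Config (Fin (2 * n + 1) × Fin (2 * n + 1))) : ℝ :=
  ∏ i, ((heightPlane (windowExtend n w) (u i).2 : ℝ) - (heightPlane (windowExtend n w) (u i).1 : ℝ))

/-- **`Φ_k(u) = ∫ windowKPoint u n (planeWindow n ω) dP`** for the window radius `n = windowRadius u`
(the integrands agree pointwise). [cite: DKLM2026SixVertexGFF, Def. 2.4] -/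
theorem kPoint_eq_integral_windowKPoint (P : Measure (Config (ℤ × ℤ))) {k : ℕ} (u : Fin k → ℂ × ℂ) :
    kPoint P k u = ∫ ω, windowKPoint u (windowRadius u) (planeWindow (windowRadius u) ω) ∂P := by
  unfold kPoint windowKPoint
  refine integral_congr_ae (Eventually.of_forall fun ω => ?_)
  refine Finset.prod_congr rfl fun i _ => ?_
  obtain ⟨h1, h2, h3, h4⟩ := abs_floor_le_windowRadius u i
  simp only [heightPlane]
  rw [heightAt_windowExtend_planeWindow ω (f := (⌊(u i).2.re⌋, ⌊(u i).2.im⌋)) h3 h4,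
    heightAt_windowExtend_planeWindow ω (f := (⌊(u i).1.re⌋, ⌊(u i).1.im⌋)) h1 h2]

/-- **`Φ_k` is an iterated torus limit**: for the planar slope-zero six-vertex measure `P`,
`Φ_k(u) = lim_{ℓ→∞} lim_{M→∞} 𝔼_{𝕋_{M,2ℓ}}[∏ᵢ (h(uᵢ') - h(uᵢ)) | balanced]`, the height
differences being read in the window of radius `windowRadius u` (inner limits exist).
[cite: DKLM2026SixVertexGFF, Thm. 2.2 and Def. 2.4] -/
theorem IsPlanarSixVertexMeasure.exists_tendsto_kPoint {a b c : ℝ} {P : Measure (Config (ℤ × ℤ))}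
    (hP : IsPlanarSixVertexMeasure a b c P) {k : ℕ} (u : Fin k → ℂ × ℂ) :
    ∃ q : ℕ → ℝ,
      (∀ ℓ : ℕ, Tendsto (fun M : ℕ => torusWindowExp a b c M (2 * ℓ) (windowRadius u) (windowKPoint u (windowRadius u)))
        atTop (𝓝 (q ℓ))) ∧ Tendsto q atTop (𝓝 (kPoint P k u)) := by
  rw [kPoint_eq_integral_windowKPoint P u]
  exact hP.exists_tendsto_integral_comp_planeWindow _ _

end Literature.Probability.LatticeModels.SixVertex

end
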